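import Summits.SmoothPoincare4.SmoothPoincare4.Theorems.ConvexBisectionAcyclicBisectionExistsBeltMonodromyChartsOriented
import HarnessLib

/-!
# N1 ▸ `node_N1_move` ▸ (d) N1-mono, brick H4-6: A FIBRED CHART FAMILY IS TRANSVERSE TO THE PAGES
# (the input `φ` of (d) v5 is an immersion `ℝ³ → ∂ Base g`, i.e. a fibred solid-torus chart around `γ_k`)
(wave 7, crux stmt-SmoothPoincare4-10508, line `modp-braid-orbits`, registered stub `stub_M2geo` (N1) ▸
`node_N1_move` ▸ sub-node (d); registered sub-goal `helper_chartFamily_fderiv_injective`)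

For the INPUT of (d) (`work/stubs/H4H7_interface.lean`, `H4Interface.N1MonoStatement` v5) — a jointly smooth family
`φ : ℝ × ℝ × ℝ → Base g` whose level `σ` lies in `page g (c · e^{iσ})` (`|σ| ≤ η₁`) and is a positively oriented
chart there — the map `p ↦ (φ p).1 ∈ ℝ⁴` has INJECTIVE differential at every `(u, r, σ)`, `|r| < 1`, `|σ| < η₁`:
the two chart directions span the page line `L = ker dΦ` (orientation clause), while the level direction `∂_σ`
has `dw (∂_σ φ) = i c e^{iσ}/2 ≠ 0` (the page coordinate `w = c e^{iσ}/2` along the family) — so `φ` is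
automatically TRANSVERSE to the pages, a fibred solid-torus chart of `∂ Base g` around the core (piece (d5)-prep
of H4-REPORT §4: the consumer's "same chart coordinates" define a genuine local trivialisation).
Everything is proved; no named facts, no `sorry`.  References: P. Griffiths, J. Harris, *Principles of Algebraic
Geometry* (1978), Ch. 0 §2 [GriffithsHarris1978]; B. Farb, D. Margalit, *A primer on mapping class groups* (2012),
§3.1 [FarbMargalit2012].
-/

noncomputable section

set_option linter.dupNamespace false

open scoped Manifold ContDiff Topology
open Set Function Metric Complex
open Literature.Topology.FourManifolds Literature.Topology.FourManifolds.LefschetzBase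

namespace Summit.SmoothPoincare4.SmoothPoincare4.Theorems.AcyclicBisectionExists.ModpBraidOrbits

variable {g : ℕ}

/-- The page coordinate along the family: `σ ↦ c e^{iσ} / 2` has derivative `i c e^{iσ} / 2 ≠ 0`. [folklore] -/
theorem hasDerivAt_half_rotated (c : ℂ) (σ : ℝ) :
    HasDerivAt (fun σ' : ℝ => c * Complex.exp ((σ' : ℂ) * Complex.I) / 2)
      (c * (Complex.exp ((σ : ℂ) * Complex.I) * Complex.I) / 2) σ := by
  have h1 : HasDerivAt (fun σ' : ℝ => (σ' : ℂ) * Complex.I) Complex.I σ := by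
    simpa using (Complex.ofRealCLM.hasDerivAt (x := σ)).mul_const Complex.I
  have h2 : HasDerivAt (fun σ' : ℝ => Complex.exp ((σ' : ℂ) * Complex.I))
      (Complex.exp ((σ : ℂ) * Complex.I) * Complex.I) σ := h1.cexp
  exact (h2.const_mul c).div_const 2

/-- **A fibred chart family is transverse to the pages** (brick H4-6).  For a jointly smooth
`φ : ℝ × ℝ × ℝ → Base g` with level `σ` in `page g (c · e^{iσ})` for `|σ| ≤ η₁` (`‖c‖ = 1`) and positively
oriented at the level `σ` (`|σ| < η₁`) at `(u, r)`, the differential of `p ↦ (φ p).1` at `(u, r, σ)` is injective.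
[cite: GriffithsHarris1978, Ch. 0 §2] -/
theorem chartFamily_fderiv_injective {c : ℂ} (hc : ‖c‖ = 1) {η₁ : ℝ} {φ : ℝ × ℝ × ℝ → Base g}
    (hφs : ContMDiff 𝓘(ℝ, ℝ × ℝ × ℝ) (𝓡∂ 4) ∞ φ)
    (hφp : ∀ u r σ, σ ∈ Icc (-η₁) η₁ → φ (u, r, σ) ∈ page g (c * Complex.exp ((σ : ℂ) * Complex.I)))
    {u r σ : ℝ} (hσ : σ ∈ Ioo (-η₁) η₁)
    (hφo : 0 < inner ℝ (deriv (fun r' => (φ (u, r', σ)).1) r) (cplxJ (deriv (fun u' => (φ (u', r, σ)).1) u))) :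
    Injective (fderiv ℝ (fun p : ℝ × ℝ × ℝ => (φ p).1) (u, r, σ)) := by
  -- the family read in `ℝ⁴`
  set F : ℝ × ℝ × ℝ → EuclideanSpace ℝ (Fin 4) := fun p => (φ p).1 with hF_def
  have hF : ContDiff ℝ ∞ F :=
    contMDiff_iff_contDiff.1 ((RegularSublevel.contMDiff_incl (isRegularLevel_rho g)).comp hφs)
  set L := fderiv ℝ F (u, r, σ) with hL_def
  have hFd : HasFDerivAt F L (u, r, σ) := ((hF.differentiable (by simp)) _).hasFDerivAt
  -- the three coordinate curves and their velocities `L eᵤ`, `L e_r`, `L e_σ`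
  have hcu : HasDerivAt (fun u' : ℝ => ((u', r, σ) : ℝ × ℝ × ℝ)) ((1, 0, 0) : ℝ × ℝ × ℝ) u :=
    (hasDerivAt_id u).prodMk (hasDerivAt_const u ((r, σ) : ℝ × ℝ))
  have hcr : HasDerivAt (fun r' : ℝ => ((u, r', σ) : ℝ × ℝ × ℝ)) ((0, 1, 0) : ℝ × ℝ × ℝ) r :=
    (hasDerivAt_const r u).prodMk ((hasDerivAt_id r).prodMk (hasDerivAt_const r σ))
  have hcσ : HasDerivAt (fun σ' : ℝ => ((u, r, σ') : ℝ × ℝ × ℝ)) ((0, 0, 1) : ℝ × ℝ × ℝ) σ :=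
    (hasDerivAt_const σ u).prodMk ((hasDerivAt_const σ r).prodMk (hasDerivAt_id σ))
  have hbu := hFd.comp_hasDerivAt u hcu
  have hbr := hFd.comp_hasDerivAt r hcr
  have hbσ := hFd.comp_hasDerivAt σ hcσ
  have eu : deriv (fun u' => (φ (u', r, σ)).1) u = L (1, 0, 0) := hbu.deriv
  have er : deriv (fun r' => (φ (u, r', σ)).1) r = L (0, 1, 0) := hbr.deriv
  rw [eu, er] at hφo
  set q : EuclideanSpace ℝ (Fin 4) := F (u, r, σ) with hq_def
  -- `dw` of the chart directions vanishes, `dw (L e_σ) = i c e^{iσ}/2 ≠ 0`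
  have hσ' : σ ∈ Icc (-η₁) η₁ := ⟨hσ.1.le, hσ.2.le⟩
  have hwu : dPhiX g q * cx (L (1, 0, 0)) + dPhiY q * cy (L (1, 0, 0)) = 0 :=
    dPhi_velocity_eq_zero_of_w_const (γ := fun u' => F (u', r, σ)) (fun u' => (hφp u' r σ hσ').2) hbu
  have hwr : dPhiX g q * cx (L (0, 1, 0)) + dPhiY q * cy (L (0, 1, 0)) = 0 :=
    dPhi_velocity_eq_zero_of_w_const (γ := fun r' => F (u, r', σ)) (fun r' => (hφp u r' σ hσ').2) hbr
  have hwσ : dPhiX g q * cx (L (0, 0, 1)) + dPhiY q * cy (L (0, 0, 1)) =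
      c * (Complex.exp ((σ : ℂ) * Complex.I) * Complex.I) / 2 := by
    have h1 := hasDerivAt_w_comp (g := g) hbσ
    have h2 : HasDerivAt (fun σ' : ℝ => w g (F (u, r, σ')))
        (c * (Complex.exp ((σ : ℂ) * Complex.I) * Complex.I) / 2) σ := by
      have hev : (fun σ' : ℝ => w g (F (u, r, σ'))) =ᶠ[nhds σ]
          fun σ' => c * Complex.exp ((σ' : ℂ) * Complex.I) / 2 := by
        have hopen : IsOpen (Ioo (-η₁) η₁) := isOpen_Ioo
        filter_upwards [hopen.mem_nhds hσ] with σ' hσ''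
        rw [(hφp u r σ' ⟨hσ''.1.le, hσ''.2.le⟩).2, mul_div_assoc]
      exact (hasDerivAt_half_rotated c σ).congr_of_eventuallyEq hev
    exact h1.unique h2
  have hwσ0 : dPhiX g q * cx (L (0, 0, 1)) + dPhiY q * cy (L (0, 0, 1)) ≠ 0 := by
    rw [hwσ]
    have hc0 : c ≠ 0 := norm_ne_zero_iff.1 (by rw [hc]; norm_num)
    exact div_ne_zero (mul_ne_zero hc0 (mul_ne_zero (Complex.exp_ne_zero _) Complex.I_ne_zero)) two_ne_zero
  -- injectivity
  intro p p' hpp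
  rw [← sub_eq_zero] at hpp ⊢
  have hL0 : L (p - p') = 0 := by rw [map_sub]; exact hpp
  set d := p - p' with hd_def
  obtain ⟨x, y, z⟩ := d
  have hdec : ((x, y, z) : ℝ × ℝ × ℝ) = x • ((1, 0, 0) : ℝ × ℝ × ℝ) + (y • ((0, 1, 0) : ℝ × ℝ × ℝ) +
      z • ((0, 0, 1) : ℝ × ℝ × ℝ)) := by simp
  have hLd : L ((x, y, z) : ℝ × ℝ × ℝ) = x • L (1, 0, 0) + (y • L (0, 1, 0) + z • L (0, 0, 1)) := by
    rw [hdec, map_add, map_add, map_smul, map_smul, map_smul]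
  rw [hLd] at hL0
  -- `z = 0` by `dw`
  have hz : z = 0 := by
    have h := congrArg (fun V : EuclideanSpace ℝ (Fin 4) => dPhiX g q * cx V + dPhiY q * cy V) hL0
    simp only [cx_add, cy_add, cx_smul, cy_smul, cx_zero, cy_zero, mul_zero, add_zero] at h
    have key : (z : ℂ) * (dPhiX g q * cx (L (0, 0, 1)) + dPhiY q * cy (L (0, 0, 1))) = 0 := by
      linear_combination h - (x : ℂ) * hwu - (y : ℂ) * hwr
    have : (z : ℂ) = 0 := by
      rcases mul_eq_zero.1 key with h' | h'
      · exact h'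
      · exact absurd h' hwσ0
    exact_mod_cast this
  rw [hz, zero_smul, add_zero] at hL0
  -- `y = 0` by the Kähler pairing with `L eᵤ`, then `x = 0`
  have hy : y = 0 := by
    have h := congrArg (fun V : EuclideanSpace ℝ (Fin 4) => inner ℝ V (cplxJ (L (1, 0, 0)))) hL0
    simp only [inner_add_left, real_inner_smul_left, inner_cplxJ_self, mul_zero, zero_add, inner_zero_left] at h
    rcases mul_eq_zero.1 h with h' | h'
    · exact h'
    · exact absurd h' hφo.ne'
  rw [hy, zero_smul, add_zero] at hL0
  have hx : x = 0 := by
    have hu0 : L (1, 0, 0) ≠ 0 := by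
      intro h0
      rw [h0, cplxJ_zero, inner_zero_right] at hφo
      exact lt_irrefl _ hφo
    rcases smul_eq_zero.1 hL0 with h' | h'
    · exact h'
    · exact absurd h' hu0
  rw [hx, hy, hz]
  rfl

/-- **Sub-goal `helper_chartFamily_fderiv_injective` of stub `stub_M2geo`** (N1 ▸ `node_N1_move` ▸ (d) N1-mono,
brick H4-6; wave 7, lead c5).  THE INPUT CHART FAMILY OF (d) IS TRANSVERSE TO THE PAGES: for a jointly smooth
`φ : ℝ × ℝ × ℝ → Base g` with level `σ` in `page g (c e^{iσ})` (`|σ| ≤ η₁`, `‖c‖ = 1`), positively oriented at every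
level, the differential of `p ↦ (φ p).1` is injective at every `(u, r, σ)` with `|r| < 1`, `|σ| < η₁`.
[cite: GriffithsHarris1978, Ch. 0 §2] -/
theorem helper_chartFamily_fderiv_injective : ∀ (g : ℕ) (c : ℂ) (η₁ : ℝ) (φ : ℝ × ℝ × ℝ → Literature.Topology.FourManifolds.LefschetzBase.Base g), ‖c‖ = 1 → ContMDiff 𝓘(ℝ, ℝ × ℝ × ℝ) (𝓡∂ 4) ∞ φ → (∀ u r σ, σ ∈ Set.Icc (-η₁) η₁ → φ (u, r, σ) ∈ Literature.Topology.FourManifolds.LefschetzBase.page g (c * Complex.exp ((σ : ℂ) * Complex.I))) → (∀ u r σ, r ∈ Set.Ioo (-1 : ℝ) 1 → σ ∈ Set.Icc (-η₁) η₁ → 0 < inner ℝ (deriv (fun r' => (φ (u, r', σ)).1) r) (Literature.Topology.FourManifolds.LefschetzBase.cplxJ (deriv (fun u' => (φ (u', r, σ)).1) u))) → ∀ (u r σ : ℝ), r ∈ Set.Ioo (-1 : ℝ) 1 → σ ∈ Set.Ioo (-η₁) η₁ → Function.Injective (fderiv ℝ (fun p : ℝ × ℝ × ℝ => (φ p).1)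 (u, r, σ)) := by
  intro g c η₁ φ hc hφs hφp hφo u r σ hr hσ
  exact chartFamily_fderiv_injective hc hφs hφp hσ (hφo u r σ hr ⟨hσ.1.le, hσ.2.le⟩)

end Summit.SmoothPoincare4.SmoothPoincare4.Theorems.AcyclicBisectionExists.ModpBraidOrbits

end
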